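import Mathlib
import HarnessLib
import HarnessLib.Audit
import Summits.ABC.Statement
import HarnessLib.Audit.Status.Attr

/-!
Route: MarkoffFrickeDescent

# Route MarkoffFrickeDescent — abc on the Markoff tree — Fricke's trace identity (3xy − z) + z = 3xy
and the radical of Markoff numbers

It suffices to show X = MarkoffRadical ∧ OffMarkoffABC. Every edge of the Markoff tree (two triples
(x,y,z), (x,y,z′) of x² + y² + z² = 3xyz
sharing x,y, with z z′ = x² + y², z + z′ = 3xy) IS a coprime abc triple (z′, z, 3xy) — Fricke's
identity tr(AB⁻¹) + tr(AB) = tr A · tr B for the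
Cohn matrices of the edge. On this log-sparse family (C·(log N)² triples below N, Zagier) abc
follows, by AM–GM z z′ ≥ 2xy and Frobenius'
pairwise coprimality, from ONE statement about Markoff numbers: MarkoffRadical = «rad m ≥ C(δ)⁻¹ ·
m^{1/2 − δ} for every Markoff number m»
(the weakest exponent the assembly needs; 1/2 is attained at m = 169 = 13², Ljunggren's square Pell
number). OffMarkoffABC is the declared
RESIDUAL (abc off the Markoff edges; abc-strength, NOT attacked). Generated by the seat's technique
card «assume the opposite: build the
counterexample until it breaks» — a violating edge forces four pairwise-coprime Markoff numbers x,
y, z, z′ with total radical < (xy)^{1−δ}, i.e.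
powerful Markoff numbers in bulk; at fixed support S this BREAKS (Corvaja–Zannier 2006: P(xy) → ∞
along the tree, Subspace Theorem) — and by the
director KEY «certified instrument / restrict-then-tighten»: Markoff's descent makes the family
exhaustively enumerable (BFS of the tree), the
instrument is the factorised tree. NOT abc: the line bears on the restricted-family rung
MARKOFF-EDGE-ABC only; no summit is proved by it.
Lean: `Summit.ABC.ABC.Theses.MarkoffFrickeDescent.MarkoffRadical ∧
Summit.ABC.ABC.Theses.MarkoffFrickeDescent.OffMarkoffABC`

## Assembly
Two genuine steps + logic (birth skeleton Sketch2.lean, `lean check` rc 0, sorries only in the two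
stubs, composition `Assembly_of` kernel-checked):
(i) `stub_markoffArithmetic` (Frobenius 1913): coordinates of a Markoff triple are pairwise coprime
and prime to 3 (descent on the tree);
(ii) `stub_edge_of_radical`: MarkoffArithmetic → MarkoffRadical → MarkoffEdgeABC — for an edge (z′,
z, 3xy): z′ = 3xy − z is again Markoff (Vieta),
rad(z′·z·3xy) = 3·rad x·rad y·rad z·rad z′ ≥ 3C⁻⁴(x y z z′)^{1/2−δ} ≥ 3C⁻⁴(2x²y²)^{1/2−δ}, and with
δ = ε/(2+2ε) this gives 3xy < C₁·rad^{1+ε};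
(iii) case split «is a Markoff edge» with C = max(C₁, C₂), concluding `ABC` (this step is PROVED in
Sketch2.lean: `Assembly_of`). `closes` is modus
ponens: Assembly → MarkoffRadical → OffMarkoffABC → ABC.

Rationale: WHY THIS LINE. New lever relative to the 40 listed routes and 118 cards (rg
Markov|Markoff|Cohn|Fricke|Christoffel over Theses and the card index: 0 hits): the
MARKOFF SURFACE and its Vieta-involution orbit — a non-abelian trace family (Fricke characters of
the free group F₂ = π₁ of the punctured torus;
Markoff number m ↔ simple closed geodesic of length 2·arcosh(3m/2) on the modular torus; edge ↔ flip
of an ideal triangulation) in place of the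
rank-1 tori (Pell/Lucas units) of the Wieferich/Pell cards and of this seat's LINE 1. Why easier
than abc: the attacked conjunct quantifies over
C(log N)² explicitly enumerable triples instead of ≍N², asks only for exponent 1/2 − δ on single
numbers (not 1 − ε on a product), and the family
carries engines abc lacks — S-unit finiteness of Markoff pairs by the Subspace Theorem
[Corvaja–Zannier, Rend. Semin. Mat. Univ. Padova 116 (2006)
253–260, zbMATH], super-strong approximation for the Markoff group mod p with divisor statistics of
Markoff numbers [arXiv:1505.06411, Thms 1–3:
«almost all Markoff numbers are composite»], and the Ghosh–Sarnak theory of integral points on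
Markoff-type cubic surfaces [doi:10.1007/s00222-022-01114-z].
Dictionary (explicit): a = tr(AB⁻¹)/3, b = tr(AB)/3, c = tr A·tr B/3 for an edge's Cohn pair (A,B) ⊂
SL₂(ℤ) [doi:10.1007/978-3-319-00888-2, Chs. 3–4,7];
rad(abc) = 3·rad x·rad y·rad z·rad z′ (Frobenius 1913: pairwise coprime, 3 ∤ m
[doi:10.1007/978-1-4899-3585-4, D12 pp.176–178]); the abc
inequality on the edge ⟸ rad m ≥ m^{1/2−δ} for the four numbers because z z′ = x² + y² ≥ 2xy.
Imported area: hyperbolic geometry / thin-group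
arithmetic of the Markoff surface; nothing from the Baker–LFL ladder or the modular-degree door is
used.

RANKED CRUXES. #2 MarkoffRadical (crux) — for every δ > 0 there is C > 0 such that every coordinate
z of a positive solution of x² + y² + z² = 3xyz satisfies z^{1/2 − δ} ≤ C · rad(z) (Markoff numbers
are not more powerful than squares, up to z^δ). [difficulty: open-problem] (why it might fail: the
branches (1,F₂ₙ₋₁,F₂ₙ₊₁), (2,P₂ₙ₋₁,P₂ₙ₊₁) are odd-index Fibonacci/Pell numbers, so a Wall–Sun–Sun
cascade or a cube-heavy Markoff number beyond 169 = 13² breaks θ = 1/2; no pointwise radical bound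
is known on any branch.) [doi:10.1007/978-3-319-00888-2, arXiv:1505.06411,
doi:10.1090/s0025-5718-1982-0669663-7, doi:10.1007/978-1-4899-3585-4]
#7 OffMarkoffABC (crux) — RESIDUAL (imported complement, not attacked): the abc inequality for abc
triples (a,b,c) that are not Markoff edges, i.e. not of the form b = z, c = 3xy with x² + y² + z² =
3xyz. [difficulty: open-problem] (why it might fail: it is abc minus a family of C(log N)² triples,
hence abc-strength (fails exactly if abc fails off the Markoff edges); declared residual, FRONTIER
accounting, never staffed by this line.) [BombieriGubler2006, doi:10.1090/s0025-5718-1982-0669663-7]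

TWO-LAYER PLAN. MarkoffRadical ⇐ (RecurrenceBranches: the bound on the Fibonacci branch x = 1 and
the Pell branch x = 2, where v_p(F_n) = v_p(F_{α(p)}) + v_p(n/α(p))
reduces it to a Wall–Sun–Sun mass statement) ∧ (GenericBranches: x ≥ 5, where the only structure is
the Markoff group action — strong approximation
mod p² [arXiv:1505.06411 «extension to composite moduli»] gives the DENSITY version «Markoff numbers
divisible by p² have relative density ≍ p⁻²»,
and the pointwise version is the crux). A statistical sibling «Σ_{m Markoff ≤ N} log(m/rad m) = o(Σ
log m)» is the natural first proved rung of the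
generic branch (BGS sieve). Filed only after a crux moves.

KILL CRITERIA. A refutation of MarkoffRadical (an infinite set of Markoff numbers with rad m ≤
m^{1/2−η}) does NOT refute abc (the edge family sits at quality ≤ 0.62
empirically) but kills this line's lever: close --reason refuted:MarkoffRadical and record the
powerful branch on LADDER-ABC A0's negative side. A proof
of abc on the Markoff edges by any other means moots the line (superseded). If the critic rules that
«restricted family + residual» with a
single-number radical crux restates LINE 1's shape without a new engine, pivot to the statistical
rung (BGS sieve) as the attacked conjunct.

NOT DECOMPOSED YET. The branch split of MarkoffRadical (two-layer plan); the uniqueness conjecture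
plays no role and is deliberately not imported; Markoff-type
surfaces x² + y² + z² = xyz + k (Ghosh–Sarnak) and the Hurwitz equations n ≥ 4 would give further
edge families — outside this route.

CHEAPEST FALSIFIER. Instrument row E-MARKOFF-RAD (certified enumeration: BFS of the Markoff tree,
Pollard-rho factorisation; census2/markoff_census.py, run 2026-08-27
to N = 10²²: 482 triples, 28 non-squarefree Markoff numbers): θ(m) := log(m/rad m)/log m has max
0.5000 at m = 169 = 13², next 0.2239 (1325 = 5²·53),
0.1759 (205272962 = 2·29²·122041), all others < 0.15 and decreasing; every square factor seen is p²
with p ∈ {2?,5,13,17,29}. Edge qualities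
q = log(3xy)/log rad(3xyzz′): max 0.6131 at (1,2,3), 0.5630 at (1,1325,1326), min 0.338, mean 0.415
— the family is far inside abc. Kill: a branch
of the tree along which θ(m) ≥ 1/2 + η persistently (refutes MarkoffRadical); the constant-free form
rad m ≥ m^{1/2} (δ = 0, C = 1) holds with
EQUALITY at 169 and is not refuted below 10²². Extending the row to 10⁴⁰ (≈ 1500 numbers, ECM) is
one kit job. Computed, not proved.

NUMBERS. Zagier: #{Markoff triples ≤ N} = C(log N)² + O(log N (log log N)²), C ≈ 0.18072
[doi:10.1090/s0025-5718-1982-0669663-7]. Frobenius: odd Markoff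
numbers ≡ 1 (mod 4), m ≢ 0 (mod 3), pairwise coprime in a triple. θ = 1/2 attained at 169 = 13²
(Pell branch: P₇ = 169, the only square Pell
number > 1, Ljunggren). For an edge with x ≤ y: 3xy/2 < z < 3xy, z′ = (x²+y²)/z ≤ y. Exponent
bookkeeping: δ = ε/(2+2ε) ⇒ (1−2δ)(1+ε) = 1.

DEFINITION REQUESTS. None now (the Markoff condition is inlined as `x^2+y^2+z^2 = 3*x*y*z`;
`MarkoffEdgeABC`, `MarkoffArithmetic` live in the skeleton).

Novelty: Searches (2026-08-27): rg 'Markov|Markoff|Cohn matri|Christoffel|Fricke' over the 40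
`Summits/ABC/ABC/Theses/*.lean`, the 118-card index
(ideas_all.json) and `Literature/**/*.lean` (0 route/card hits; Literature has EDS/elliptic-net
files only); `lit search "Markoff numbers abc
conjecture"` (local 7 docs: corpus:paper:arxiv-math_0312440 Waldschmidt «Open Diophantine Problems»
pp.1,3 (Markoff spectrum; Langevin: abc ⇒
stronger-than-Roth) — no Markoff-tree/abc link; corpus:book:guy1994 D12 pp.176–178); `lit search
"greatest prime factor Markov pairs Corvaja
Zannier"` (zbMATH: Rend. Semin. Mat. Univ. Padova 116 (2006) 253–260 «P(xy) → ∞»;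
corpus:paper:arxiv-1504.07099 p.8 cites it); `lit read
arXiv:1505.06411` (BGS Thms 1–3, held); `lit search --hybrid "Markoff numbers pairwise relatively
prime uniqueness conjecture Aigner"` (8 books, Guy
D12 the only relevant); `lit galaxy search "Markoff pairs|Markov pairs|Markoff numbers are
composite|prime factors of Markoff" --star all` (7 rows, 0
relevant) and `--star panama --title-contains Markoff` (1 row, a novel); `ledger negatives --problem
ABC` (no Markoff statement).
Nearest prior art found: route-ABC-ThinOrbitABC / card `thin-orbit-abc-exceptions` (retired
not-a-thesis; new-combination): expansion for thin
LINEAR SL₂-orbits (Pythagorean/Zaremba) bounding abc EXCEPTIONAL-SET COUNTS — different object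
(linear orbit on ℤ², δ_Γ < 1), different claim
(almost-all), no Markoff surface, no Fricke triple; this seat's route-ABC-StormerPellDe  [refs: 10.1007/978-3-319-00888-2, 1505.06411, paper:arxiv-math_0312440, book:guy1994, paper:arxiv-1504.07099, doi:10.1007/978-3-319-00888-2]

Barriers (technique_class: markoff-surface, vieta-descent, subspace-theorem): - technique_class: markoff-surface, vieta-descent, subspace-theorem
- Literature.Barriers.ABC.BakerMethodBounds: outside — no linear form in logarithms; the line's wall
is the pointwise-radical wall for a log-sparse orbit (priced in MarkoffRadical), not the
exp(rad^{1/3}) ceiling.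
- Literature.Barriers.ABC.EpsilonCannotBeDropped: honoured — the residual keeps 1+ε and a constant;
on the edge family itself quality ≤ 0.62 empirically, so no ε-free claim is made or needed.
- Literature.Barriers.ABC.ExplicitABCQualityFloor: honoured — ∃C statements only; the calibration
θ(169) = 1/2 is recorded under Numbers, no constant-free claim filed.
- Literature.Barriers.ABC.IntegersHaveNoDerivation: not in this technique class.
- Literature.Barriers.ABC.IUTDisputedClaim: no side taken on [IUTchIII] Cor. 3.12; nothing depends
on it.
- Negatives index: stmt-ABC-1205 (BelyiSqueeze) and stmt-ABC-1689 (GlobalQuasiLogDerivative)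
unrelated; no Markoff statement refuted at filing.

History (route lifecycle, newest last):
- 2026-08-27T21:43:44Z · rev 1: restated MarkoffRadical (stmt-ABC-22692) — revision b: restate MarkoffRadical 1:1 to its EDGE form (xyzw)^{1/2−δ} ≤ C·rad(xyzw) — the weakest statement the assembly needs (pointwise form implies it by Fr (planner-abc-idea-3-g0-0)

sub-problem: ABC · status: draft · opened planner-abc-idea-3-g0-0 2026-08-27T21:11:33Z · rev 1 · ledger route-ABC-MarkoffFrickeDescent
GENERATED by the gate from the ledger (D-0016/17). Provers cite these decls: `theorem foo : Summit.ABC.ABC.Theses.MarkoffFrickeDescent.<Decl> := …` in Summits/ABC/ABC/Theorems/<Name>.lean.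
-/

namespace Summit.ABC.ABC.Theses.MarkoffFrickeDescent

open scoped BigOperators Topology Manifold Classical MeasureTheory ProbabilityTheory Matrix InnerProductSpace ComplexConjugate ContinuousMap
open Filter Set Function TopologicalSpace MeasureTheory

attribute [summit_statement] _root_.ABC

open Literature.Abc

-- earlier MarkoffRadical (stmt-ABC-22692, replaced 2026-08-27T21:43:44Z -> stmt-ABC-22984): retired by None — ∀ δ : ℝ, 0 < δ → ∃ C : ℝ, 0 < C ∧ ∀ x y z : ℕ, 0 < x → 0 < y → 0 < z → x ^ 2 + y ^ 2 + z ^ 2 = 3 * x * y * z → (z : ℝ) ^ ((1 / 2 : ℝ) - δ) ≤ C * ((UniqueFactorizationMonoid.radical z : ℕ) : ℝ)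
/-- item stmt-ABC-22984 · crux · rank 2 · open · by planner
why it might fail: @wmf2b.txt
sources: Corvaja–Zannier 2006 (Rend. Semin. Mat. Univ. Padova 116, 253–260): greatest prime factor of xy for Markoff triples → ∞ (Subspace), arXiv:1505.06411 (Bourgain–Gamburd–Sarnak, Markoff triples and strong approximation), kit job E-MARKOFF-RAD census (folder census2/markoff_1e22.out; evidence E-MARKOFF-RAD-1e22.txt on stmt-ABC-22692)
[crux] MARKOFF EDGE RADICAL (revision b = the WEAKEST form the assembly needs): for every Markoff
edge — triples (x,y,z) ~ (x,y,w) of x²+y²+z² = 3xyz with z + w = 3xy (hence zw = x²+y²) — the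
product of the four coordinates satisfies (xyzw)^{1/2−δ} ≤ C(δ)·rad(xyzw). Implied by the pointwise
form «rad m ≥ C⁻¹ m^{1/2−δ} for every Markoff number m» (revision a; calibrated by instrument
E-MARKOFF-RAD: θ(m) = log(m/rad m)/log m over the 481 Markoff numbers ≤ 10²² has max exactly 1/2 at
169 = 13², next 0.224; edge defect max 0.237) via Frobenius' pairwise coprimality, but strictly
weaker: one powerful coordinate may be compensated by its three coprime neighbours. QUALITATIVE
SHADOW PROVED: for fixed finite S only finitely many Markoff triples have x, y both S-units
(Corvaja–Zannier 2006, Subspace theorem) — so xyzw is an S-unit on finitely many edges; statistical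
shadow: Bourgain–Gamburd–Sarnak strong approximation for the Markoff group (arXiv:1505.06411). With
this form the route's Assembly is PROVED outright (folder Sketch2b.lean `assembly_holds`, rc 0, 0
sorry, no arithmetic stub: rad(xyzw) | rad(abc) since abc = 3·xyzw, (xy)² ≤ xyzw, δ = ε/(2+2ε)). -/
@[route_item "route-ABC-MarkoffFrickeDescent", crux]
def MarkoffRadical : Prop :=
  ∀ δ : ℝ, 0 < δ → ∃ C : ℝ, 0 < C ∧ ∀ x y z w : ℕ, 0 < x → 0 < y → 0 < z → 0 < w → x ^ 2 + y ^ 2 + z ^ 2 = 3 * x * y * z → z + w = 3 * x * y → ((x * y * z * w : ℕ) : ℝ) ^ ((1 / 2 : ℝ) - δ) ≤ C * ((UniqueFactorizationMonoid.radical (x * y * z * w) : ℕ) : ℝ)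

/-- item stmt-ABC-22693 · crux · rank 7 · open · by planner
why it might fail: it is abc minus a family of C(log N)² triples, hence abc-strength (fails exactly if abc fails off the Markoff edges); declared residual, FRONTIER accounting, never staffed by this line.
sources: BombieriGubler2006, doi:10.1090/s0025-5718-1982-0669663-7
[crux] RESIDUAL (imported complement, not attacked): the abc inequality for abc triples (a,b,c) that
are not Markoff edges, i.e. not of the form b = z, c = 3xy with x² + y² + z² = 3xyz. [difficulty:
open-problem] -/
@[route_item "route-ABC-MarkoffFrickeDescent", crux]
def OffMarkoffABC : Prop :=
  ∀ ε : ℝ, 0 < ε → ∃ C : ℝ, 0 < C ∧ ∀ a b c : ℕ, Literature.NumberTheory.DiophantineGeometry.IsABCTriple a b c → (¬ ∃ x y z : ℕ, 0 < x ∧ 0 < y ∧ 0 < z ∧ x ^ 2 + y ^ 2 + z ^ 2 = 3 * x * y * z ∧ b = z ∧ c = 3 * x * y) → (c : ℝ) < C * ((Literature.NumberTheory.DiophantineGeometry.rad a b c : ℕ) : ℝ) ^ (1 + ε)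

/-- item stmt-ABC-22694 · assembly · rank 1 · open · by planner
sources: doi:10.1007/978-3-319-00888-2
[assembly] MarkoffRadical → OffMarkoffABC → ABC (provable now modulo the two M-sized stubs above;
composition kernel-checked in Sketch2.lean; `closes` is modus ponens through it) -/
@[route_item "route-ABC-MarkoffFrickeDescent", crux]
def Assembly : Prop :=
  MarkoffRadical → OffMarkoffABC → ABC

/-! D-0027 §2.1 — DECIDING THEOREM (planner-authored via `route open/edit --closes-file`; by planner-abc-idea-3-g0-0 2026-08-27T21:11:33Z):
its hypotheses are this route's items and its conclusion the sub-problem Statement (glue_lint), and it elaborates with this file. -/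

@[closes "route-ABC-MarkoffFrickeDescent"] theorem closes (hA : Assembly) (h₁ : MarkoffRadical) (h₂ : OffMarkoffABC) : ABC :=
  hA h₁ h₂

end Summit.ABC.ABC.Theses.MarkoffFrickeDescent
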